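import Literature.Probability.Percolation.FiveArmExponentFacts
import Literature.Probability.Percolation.ArmEventsBoundedRatio
import HarnessLib

/-!
# Extendability of the arm events from quasi-multiplicativity (Nolin 2008, Prop. 16, at `p = 1/2`)

Topic: Probability / Percolation; family `crit-perc` (critical site percolation on the triangular
lattice `𝕋`; the order-free arm events `armEvent κ r R` and `polyArmProb κ r R = P_{1/2}(armEvent κ r R)`
of `ArmEvents.lean`). PROOFS ONLY: corollaries of the named fact
`Literature.Probability.Percolation.Nolin2008_prop17_quasiMult` (`FiveArmExponentFacts.lean`;
P. Nolin, *Near-critical percolation in two dimensions*, EJP 13 (2008), §4.5 Prop. 17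
[arXiv 0711.4948: Prop. 16], quasi-multiplicativity, gluing half, `p = 1/2`), in the conditional
form `(h : Nolin2008_prop17_quasiMult) → …` usable by its dependents.

Nolin's Prop. 16 [arXiv Prop. 15], "Extendability": `P̂(A_{j,σ}(n, 2N)), P̂(A_{j,σ}(n/2, N)) ≍
P̂(A_{j,σ}(n, N))` — "once well-separated, the arms can easily be extended". In print it is deduced
from the arm-separation theorem (Thm. 11) and the extendability of the well-separated events
(Prop. 12 (i)); here, at `p = 1/2`, it is read off quasi-multiplicativity and the bounded-ratio
lower bound `polyArmProb κ m N ≥ a(B, k) > 0` for `N ≤ B m` (`exists_le_polyArmProb_of_le_mul_any`,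
Nolin §4.1 item 3 / Prop. 14 lower half [arXiv Prop. 13]):
`P(A(n, N')) ≥ c · P(A(n, N)) · P(A(N, N')) ≥ c a · P(A(n, N))` for `N ≤ N' ≤ B N`, and
`P(A(n, N)) ≥ c · P(A(n, n')) · P(A(n', N)) ≥ c a · P(A(n', N))` for `n ≤ n' ≤ B n`. The other
inequalities of the `≍` are the trivial monotonicity `polyArmProb_anti_holds`
(resp. `armEvent κ n N ⊆ armEvent κ n' N` up to truncation, not restated here).

* `Nolin2008_prop17_quasiMult.extend_outer` — `c · polyArmProb κ n N ≤ polyArmProb κ n N'` for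
  `n₀ ≤ n < N ≤ N' ≤ B N`;
* `Nolin2008_prop17_quasiMult.extend_inner` — `c · polyArmProb κ n' N ≤ polyArmProb κ n N` for
  `n₀ ≤ n ≤ n' ≤ B n`, `n' < N`.

Everything is proved; no named fact is introduced (D-0026).

## References

* P. Nolin, *Near-critical percolation in two dimensions*, Electron. J. Probab. 13 (2008)
  1562–1623, §4.5 Prop. 16 (extendability) and Prop. 17 (quasi-multiplicativity), §4.1 item 3
  (arXiv 0711.4948: Prop. 15, Prop. 16, p. 8). [Nolin2008]
* H. Kesten, *Scaling relations for 2D-percolation*, Comm. Math. Phys. 109 (1987), Lemma 4–6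
  (extension of arms through fences). [Kesten1987]

Tree: `Nolin2008_prop17_quasiMult` (`FiveArmExponentFacts.lean`), `exists_le_polyArmProb_of_le_mul_any`
(`ArmEventsBoundedRatio.lean`), `polyArmProb_nonneg`, `polyArmProb_le_one` (`ArmEventsProofs.lean`).
-/

noncomputable section

namespace Literature.Probability.Percolation

open LatticeModels

/-- **Nolin 2008, Prop. 16 [arXiv Prop. 15], outward extendability at `p = 1/2`, from Prop. 17:**
for every pattern `κ` and ratio bound `B ≥ 1` there are `c > 0` and `n₀` with
`c · P_{1/2}(armEvent κ n N) ≤ P_{1/2}(armEvent κ n N')` whenever `n₀ ≤ n < N ≤ N' ≤ B N` — the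
arms are extended from `∂Λ_N` to `∂Λ_{N'}` at constant cost (quasi-multiplicativity glued with the
bounded-ratio lower bound `P_{1/2}(armEvent κ N N') ≥ a`). [cite: Nolin2008, §4.5 Prop. 16 (arXiv 0711.4948: Prop. 15), via Prop. 17 and §4.1 item 3] -/
theorem Nolin2008_prop17_quasiMult.extend_outer (h : Nolin2008_prop17_quasiMult) {k : ℕ} (κ : Fin k → Bool)
    (B : ℕ) (hB : 1 ≤ B) :
    ∃ c : ℝ, 0 < c ∧ ∃ n₀ : ℕ, ∀ n N N' : ℕ, n₀ ≤ n → n < N → N ≤ N' → N' ≤ B * N →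
      c * polyArmProb κ n N ≤ polyArmProb κ n N' := by
  obtain ⟨c, hc, n₀, hq⟩ := h κ
  obtain ⟨a, ha, hlow⟩ := exists_le_polyArmProb_of_le_mul_any κ B hB
  have ha1 : a ≤ 1 := (hlow (2 * (k + 1)) (2 * (k + 1)) le_rfl le_rfl (by nlinarith)).trans (polyArmProb_le_one _ _ _)
  refine ⟨min c 1 * a, mul_pos (lt_min hc one_pos) ha, max n₀ (2 * (k + 1)), fun n N N' hn hnN hNN' hN'B => ?_⟩
  have hn₀ : n₀ ≤ n := le_of_max_le_left hn
  have hk : 2 * (k + 1) ≤ n := le_of_max_le_right hn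
  have hP := polyArmProb_nonneg κ n N
  rcases Nat.lt_or_ge N N' with hlt | hge
  · -- quasi-multiplicativity at the radii `n < N < N'`, and the lower bound for `(N, N')`
    have q := hq n N N' hn₀ hnN hlt
    have l := hlow N N' (by omega) hNN' hN'B
    calc min c 1 * a * polyArmProb κ n N
        ≤ c * (polyArmProb κ n N * polyArmProb κ N N') := by
          rw [mul_assoc, mul_comm a]
          exact mul_le_mul (min_le_left _ _) (mul_le_mul_of_nonneg_left l hP) (by positivity) hc.le
      _ ≤ polyArmProb κ n N' := q
  · -- `N' = N`
    have hNN : N' = N := le_antisymm hge hNN'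
    subst hNN
    calc min c 1 * a * polyArmProb κ n N' ≤ 1 * 1 * polyArmProb κ n N' :=
          mul_le_mul_of_nonneg_right (mul_le_mul (min_le_right _ _) ha1 ha.le zero_le_one) hP
      _ = polyArmProb κ n N' := by ring

/-- **Nolin 2008, Prop. 16 [arXiv Prop. 15], inward extendability at `p = 1/2`, from Prop. 17:**
for every pattern `κ` and ratio bound `B ≥ 1` there are `c > 0` and `n₀` with
`c · P_{1/2}(armEvent κ n' N) ≤ P_{1/2}(armEvent κ n N)` whenever `n₀ ≤ n ≤ n' ≤ B n` and
`n' < N` — the arms are extended from `∂Λ_{n'}` inward to `∂Λ_n` at constant cost. [cite: Nolin2008, §4.5 Prop. 16 (arXiv 0711.4948: Prop. 15), via Prop. 17 and §4.1 item 3] -/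
theorem Nolin2008_prop17_quasiMult.extend_inner (h : Nolin2008_prop17_quasiMult) {k : ℕ} (κ : Fin k → Bool)
    (B : ℕ) (hB : 1 ≤ B) :
    ∃ c : ℝ, 0 < c ∧ ∃ n₀ : ℕ, ∀ n n' N : ℕ, n₀ ≤ n → n ≤ n' → n' ≤ B * n → n' < N →
      c * polyArmProb κ n' N ≤ polyArmProb κ n N := by
  obtain ⟨c, hc, n₀, hq⟩ := h κ
  obtain ⟨a, ha, hlow⟩ := exists_le_polyArmProb_of_le_mul_any κ B hB
  have ha1 : a ≤ 1 := (hlow (2 * (k + 1)) (2 * (k + 1)) le_rfl le_rfl (by nlinarith)).trans (polyArmProb_le_one _ _ _)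
  refine ⟨min c 1 * a, mul_pos (lt_min hc one_pos) ha, max n₀ (2 * (k + 1)), fun n n' N hn hnn' hn'B hn'N => ?_⟩
  have hn₀ : n₀ ≤ n := le_of_max_le_left hn
  have hk : 2 * (k + 1) ≤ n := le_of_max_le_right hn
  have hP := polyArmProb_nonneg κ n' N
  rcases Nat.lt_or_ge n n' with hlt | hge
  · -- quasi-multiplicativity at the radii `n < n' < N`, and the lower bound for `(n, n')`
    have q := hq n n' N hn₀ hlt hn'N
    have l := hlow n n' hk hnn' hn'B
    calc min c 1 * a * polyArmProb κ n' N
        ≤ c * (polyArmProb κ n n' * polyArmProb κ n' N) := by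
          rw [mul_assoc]
          exact mul_le_mul (min_le_left _ _) (mul_le_mul_of_nonneg_right l hP) (by positivity) hc.le
      _ ≤ polyArmProb κ n N := q
  · -- `n' = n`
    have hnn : n' = n := le_antisymm hge hnn'
    subst hnn
    calc min c 1 * a * polyArmProb κ n' N ≤ 1 * 1 * polyArmProb κ n' N :=
          mul_le_mul_of_nonneg_right (mul_le_mul (min_le_right _ _) ha1 ha.le zero_le_one) hP
      _ = polyArmProb κ n' N := by ring

end Literature.Probability.Percolation

end
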